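import Summits.CriticalPhenomena.PercolationContinuityZ3.Theorems.PercNearOneGluingNoHeavyQuantTwinMove
import HarnessLib

/-!
# QUANT lane R8, T-DEC, leg (III): THE TWIN MOVE LEMMA, part 2 of 2 — the kernel reductions
# `TwinMoveDEC ⟹` the blob gate move (M) for EVERY blob size `a` (typer g27's `decAtT_gateMoveBlob` without the no-atom-below-`a` hypothesis)
# `⟹ SDECUpTo x Q M μ → SDECUpTo x Q (M + a) (slice μ a g)` for every heavy blob `{0, a; g}` and every top-affordable law `μ` (= PM in full)

builds on p205010 (kernel theorem, internal audit signed; external expert review pending)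

Support file (`--supports stmt-CriticalPhenomena-4575`), QUANT lane seat prim-quant-arm-1 (gen 39), rung R8 of
`run/shared/lean/prim/quant/LADDER.md`.  Theorems only (no definitions), standard axioms, no sorries.  Part 1: `…QuantTwinMove`
(`@[conjecture] LawDec.TwinMoveDEC`, `twinMove_of_lt`).  The proofs are typer g27's (`…QuantGateMoveBlob`: `decAtT_gateMoveBlob`,
`sdecUpTo_slice_relay`) with the hypothesis `(1−g)·ν k = 0 (0 < k < a)` replaced by `TwinMoveDEC` applied to `R = (slice ν a g − z·{0,a;g})/(1−z)`
(whose atoms below `a` have twins) and `1 ↦ a` in the slice/gate commutation.  Memo `run/shared/lean/prim/quant/prim-quant-arm-1-g39/TWIN-MOVE-G39.md`.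

* **`LawDec.decAtT_gateMoveBlob_of_twinMove`** — `TwinMoveDEC →` for `0 < y < 1`, `0 ≤ z ≤ ν 0`, `g ≤ 1`, `y ≤ (1−z)g`, `1 ≤ a`, `ν` a
  probability law on `{0..M}` with mean `S`, `y·M ≤ S`: `slice ν a g ∈ D_y(S + ag, j) ⟹ slice ν a g + gz(δ₀ − δ_a) ∈ D_y(S + ag − zag, j)`.
* **`LawDec.sdecUpTo_slice_blob_of_twinMove`** — `TwinMoveDEC → SDECUpTo x Q M μ → SDECUpTo x Q (M + a) (slice μ a g)`
  (`0 < x`, `Q ≤ 1`, `Qx < 1`, `x ≤ g ≤ 1`, `1 ≤ a`, `μ` top-affordable probability law; NO domination hypothesis);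
  `LawDec.sdec_slice_blob_of_twinMove` (`Q = 1`).

HONEST STATUS: conditional on `TwinMoveDEC` (OPEN for `j ≥ a`); `GateMove`, `GatedConvEmptyFree`, `SDECConvClosed`, `SingleGateConvClosed`,
`TreeDEC`, `FarTreeRow` OPEN; the RATE class log\* and the honest sentence of `run/shared/lean/prim/quant/README.md` are unchanged.

[this work]; (M), the flow transfer and `sdecUpTo_slice_relay`: prim-quant-stmt g27; slice theorem: prim-quant-stmt g24 / prim-quant-census-2
g54–g55 (this lane).  Nothing here is cited as a published result.  The gluing rows served [cite: KozmaNitzan2024, Conjecture 3 (p. 15)];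
product measure [cite: Grimmett1999, §1.3 p. 10].
-/

noncomputable section

namespace Summit.CriticalPhenomena.PercolationContinuityZ3.Theorems

namespace Quant

open Finset

/-- the two-point law `{lo, hi; g}` (as in `…QuantLawDEC`) -/
local notation3 "TP[" lo ", " hi ", " g ", " h "]" =>
  (g : ℝ) * (if (h : ℕ) = (hi : ℕ) then (1 : ℝ) else 0) + (1 - (g : ℝ)) * (if (h : ℕ) = (lo : ℕ) then (1 : ℝ) else 0)

namespace LawDec

/-! ### `TwinMoveDEC ⟹` the move lemma (M) for every blob size -/

/-- **`TwinMoveDEC ⟹ (M) FOR EVERY `a`** — typer g27's `decAtT_gateMoveBlob` WITHOUT the hypothesis `(1−g)·ν k = 0 (0 < k < a)`: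
`0 < y < 1`, `0 ≤ z ≤ ν 0`, `g ≤ 1`, `y ≤ (1−z)g`, `1 ≤ a`, `ν` a probability law on `{0..M}` with mean `S`, `y·M ≤ S`;
`slice ν a g ∈ D_y(S + ag, j) ⟹ slice ν a g + gz(δ₀ − δ_a) ∈ D_y(S + ag − zag, j)`.  Apply `TwinMoveDEC` to
`R = (slice ν a g − z·{0,a;g})/(1−z)` (`= slice ν̂ a g`), whose atoms below `a` have twins. [this work] -/
theorem decAtT_gateMoveBlob_of_twinMove (hTM : TwinMoveDEC) (y z g S : ℝ) (a j M : ℕ) (ν : ℕ → ℝ)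
    (hy0 : 0 < y) (hy1 : y < 1) (hz0 : 0 ≤ z) (hg1 : g ≤ 1) (hyg : y ≤ (1 - z) * g) (ha : 1 ≤ a)
    (hν0 : ∀ h, 0 ≤ ν h) (hνM : ∀ h, M < h → ν h = 0) (hν1 : ∑ h ∈ Finset.range (M + 1), ν h = 1)
    (hS : S = ∑ h ∈ Finset.range (M + 1), (h : ℝ) * ν h) (hta : y * (M : ℝ) ≤ S) (hzν : z ≤ ν 0)
    (hΛ : DECAtT y (S + (a : ℝ) * g) j (M + a) (slice ν a g)) :
    DECAtT y (S + (a : ℝ) * g - z * (a : ℝ) * g) j (M + a)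
      (fun h => slice ν a g h + g * z * ((if h = 0 then (1 : ℝ) else 0) - (if h = a then (1 : ℝ) else 0))) := by
  classical
  have hzle : z ≤ 1 := by
    have h0 := Finset.single_le_sum (fun h _ => hν0 h) (Finset.mem_range.2 (Nat.succ_pos M))
    rw [hν1] at h0
    exact hzν.trans h0
  have hz1 : z < 1 := by
    rcases hzle.eq_or_lt with h | h
    · exfalso; rw [h, sub_self, zero_mul] at hyg; linarith
    · exact h
  have h1z : 0 < 1 - z := by linarith
  have hg0 : 0 < g := by
    by_contra hc
    have : (1 - z) * g ≤ 0 := mul_nonpos_of_nonneg_of_nonpos h1z.le (not_lt.1 hc)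
    linarith
  have ha0 : a ≠ 0 := by omega
  have ha0' : (0 : ℝ) < a := by exact_mod_cast ha
  -- the law `R`
  set R : ℕ → ℝ := fun h => (slice ν a g h - z * TP[0, a, g, h]) / (1 - z) with hR
  have hRdef : ∀ h, (1 - z) * R h = slice ν a g h - z * TP[0, a, g, h] := fun h => by
    simp only [hR]; field_simp
  -- values of the slice and of the blob at the special atoms
  have hTP : ∀ h, TP[0, a, g, h] = g * (if h = a then (1 : ℝ) else 0) + (1 - g) * (if h = 0 then (1 : ℝ) else 0) := fun h => rfl
  have hR0 : ∀ h, 0 ≤ R h := by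
    intro h
    simp only [hR]
    refine div_nonneg ?_ h1z.le
    by_cases h0 : h = 0
    · subst h0
      rw [if_neg (Ne.symm ha0), if_pos rfl, slice_apply_of_lt ν a g 0 (by omega)]
      nlinarith [hν0 0]
    · rw [if_neg h0]
      by_cases hha : h = a
      · subst hha
        rw [if_pos rfl, slice_apply_self]
        nlinarith [hν0 h, hν0 0]
      · rw [if_neg hha, mul_zero, mul_zero, add_zero, mul_zero, sub_zero]
        exact slice_nonneg ν a g hg0.le hg1 hν0 h
  have hRN : ∀ h, M + a < h → R h = 0 := by
    intro h hh
    simp only [hR]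
    rw [slice_eq_zero ν a g M hνM h hh]
    have h1 : ¬ (h = a) := by omega
    have h2 : ¬ (h = 0) := by omega
    simp only [h1, h2, if_false, mul_zero, add_zero, sub_zero, zero_div]
  have hsumTP : ∑ h ∈ Finset.range (M + a + 1), TP[0, a, g, h] = 1 := by
    rw [Finset.sum_add_distrib, ← Finset.mul_sum, ← Finset.mul_sum, Finset.sum_ite_eq' (Finset.range (M + a + 1)) a,
      if_pos (Finset.mem_range.2 (by omega)), Finset.sum_ite_eq' (Finset.range (M + a + 1)) 0,
      if_pos (Finset.mem_range.2 (by omega))]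
    ring
  have hsumhTP : ∑ h ∈ Finset.range (M + a + 1), (h : ℝ) * TP[0, a, g, h] = (a : ℝ) * g := by
    have e : ∀ h : ℕ, (h : ℝ) * (g * (if h = a then (1 : ℝ) else 0) + (1 - g) * (if h = 0 then (1 : ℝ) else 0))
        = (if h = a then (a : ℝ) * g else 0) := by
      intro h
      by_cases hha : h = a
      · rw [hha]; simp [ha0]
      · by_cases h0 : h = 0
        · rw [h0]; simp [Ne.symm ha0]
        · simp [hha, h0]
    simp_rw [e]
    rw [Finset.sum_ite_eq' (Finset.range (M + a + 1)) a, if_pos (Finset.mem_range.2 (by omega))]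
  have hR1 : ∑ h ∈ Finset.range (M + a + 1), R h = 1 := by
    have e : (1 - z) * ∑ h ∈ Finset.range (M + a + 1), R h = 1 - z := by
      rw [Finset.mul_sum, Finset.sum_congr rfl (fun h _ => hRdef h), Finset.sum_sub_distrib, ← Finset.mul_sum,
        sum_slice ν a g M hνM hν1, hsumTP]
      ring
    have := mul_left_cancel₀ h1z.ne' (e.trans (mul_one (1 - z)).symm)
    exact this
  have hmeanR : (1 - z) * ∑ h ∈ Finset.range (M + a + 1), (h : ℝ) * R h = S + (a : ℝ) * g - z * (a : ℝ) * g := by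
    have e : ∀ h : ℕ, (1 - z) * ((h : ℝ) * R h) = (h : ℝ) * slice ν a g h - z * ((h : ℝ) * TP[0, a, g, h]) := by
      intro h; rw [mul_left_comm, hRdef h]; ring
    rw [Finset.mul_sum, Finset.sum_congr rfl (fun h _ => e h), Finset.sum_sub_distrib, ← Finset.mul_sum,
      sum_mul_slice ν a g M hνM hν1, hsumhTP, ← hS]
    ring
  have htwin : ∀ k, k < a → g * R k ≤ (1 - g) * R (k + a) := by
    intro k hk
    have ht1 : TP[0, a, g, k] = (1 - g) * (if k = 0 then (1 : ℝ) else 0) := by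
      have hka : ¬ (k = a) := by omega
      simp only [hka, if_false, mul_zero, zero_add]
    have ht2 : TP[0, a, g, k + a] = g * (if k = 0 then (1 : ℝ) else 0) := by
      have e3 : (k + a = a) ↔ (k = 0) := by omega
      have e4 : ¬ (k + a = 0) := by omega
      simp only [e3, e4, if_false, mul_zero, add_zero]
    have hs2 : slice ν a g (k + a) = (1 - g) * ν (k + a) + g * ν k := by
      simp only [slice, if_pos (Nat.le_add_left a k), Nat.add_sub_cancel]
    have e1 : (1 - z) * (g * R k) = g * ((1 - g) * ν k) - g * z * (1 - g) * (if k = 0 then (1 : ℝ) else 0) := by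
      rw [mul_left_comm, hRdef k, slice_apply_of_lt ν a g k hk, ht1]; ring
    have e2 : (1 - z) * ((1 - g) * R (k + a))
        = (1 - g) * ((1 - g) * ν (k + a) + g * ν k) - (1 - g) * z * g * (if k = 0 then (1 : ℝ) else 0) := by
      rw [mul_left_comm, hRdef (k + a), hs2, ht2]; ring
    have key : (1 - z) * (g * R k) ≤ (1 - z) * ((1 - g) * R (k + a)) := by
      rw [e1, e2]
      nlinarith [hν0 (k + a), mul_nonneg (mul_nonneg (by linarith : (0:ℝ) ≤ 1 - g) (by linarith : (0:ℝ) ≤ 1 - g)) (hν0 (k + a))]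
    exact le_of_mul_le_mul_left key h1z
  have htaR : y * ((M + a : ℕ) : ℝ) ≤ (1 - z) * ∑ h ∈ Finset.range (M + a + 1), (h : ℝ) * R h := by
    rw [hmeanR]; push_cast
    have : y * (a : ℝ) ≤ (1 - z) * g * a := mul_le_mul_of_nonneg_right hyg ha0'.le
    nlinarith
  -- the two laws as functions of `R`
  have eΛ : (fun h => z * TP[0, a, g, h] + (1 - z) * R h) = slice ν a g := by
    funext h; rw [hRdef h]; ring
  have eP : (fun h => z * (if h = 0 then (1 : ℝ) else 0) + (1 - z) * R h)
      = (fun h => slice ν a g h + g * z * ((if h = 0 then (1 : ℝ) else 0) - (if h = a then (1 : ℝ) else 0))) := by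
    funext h; rw [hRdef h]; ring
  have eτ : z * (a : ℝ) * g + (1 - z) * ∑ h ∈ Finset.range (M + a + 1), (h : ℝ) * R h = S + (a : ℝ) * g := by
    rw [hmeanR]; ring
  have key := hTM y z g a j (M + a) R hy0 hy1 hz0 hz1 hg1 hyg ha (by omega) hR0 hRN hR1 htwin htaR
    (by rw [eτ, eΛ]; exact hΛ)
  rw [hmeanR, eP] at key
  exact key

/-! ### `TwinMoveDEC ⟹` SDEC up to any gate level is closed under slicing by any heavy blob -/

/-- **`TwinMoveDEC ⟹ SDEC-UP-TO-`Q` IS CLOSED UNDER SLICING BY A HEAVY BLOB `{0, a; g}` OF ANY SIZE** (`x ≤ g ≤ 1`, `1 ≤ a`, NO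
domination hypothesis): `μ` a top-affordable probability law on `{0..M}`, SDEC up to `Q` at floor `x` (`0 < x`, `Q ≤ 1`, `Qx < 1`) ⟹
`slice μ a g` is SDEC up to `Q` at `x` on `{0..M+a}` — per gate `q ≤ Q`, the slice theorem gives `slice (gate_q μ) a g ∈ D(qT + ag)` and
`decAtT_gateMoveBlob_of_twinMove` turns it into `gate_q (slice μ a g) ∈ D(q(T + ag))` (typer g27's `sdecUpTo_slice_relay`, verbatim,
with `1 ↦ a`).  = PM in full: the blob case of leg (III). [this work] -/
theorem sdecUpTo_slice_blob_of_twinMove (hTM : TwinMoveDEC) (x Q g : ℝ) (M a : ℕ) (μ : ℕ → ℝ) (hx0 : 0 < x) (hQ1 : Q ≤ 1)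
    (hQx : Q * x < 1) (hxg : x ≤ g) (hg1 : g ≤ 1) (ha : 1 ≤ a) (hμ0 : ∀ h, 0 ≤ μ h) (hμM : ∀ h, M < h → μ h = 0)
    (hμ1 : ∑ h ∈ Finset.range (M + 1), μ h = 1)
    (hta : x * (M : ℝ) ≤ ∑ h ∈ Finset.range (M + 1), (h : ℝ) * μ h)
    (hS : SDECUpTo x Q M μ) :
    SDECUpTo x Q (M + a) (slice μ a g) := by
  intro q hq0 hqQ j hj
  set T : ℝ := ∑ h ∈ Finset.range (M + 1), (h : ℝ) * μ h with hT
  set y : ℝ := q * x with hy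
  have hq1 : q ≤ 1 := hqQ.trans hQ1
  have hy0 : 0 < y := mul_pos hq0 hx0
  have hy1 : y < 1 := lt_of_le_of_lt (mul_le_mul_of_nonneg_right hqQ hx0.le) hQx
  have hyqg : y ≤ q * g := mul_le_mul_of_nonneg_left hxg hq0.le
  have hqg1 : q * g ≤ 1 := by nlinarith
  have ha0' : (0 : ℝ) < a := by exact_mod_cast ha
  obtain ⟨n0, nM, n1⟩ := gate_laws M μ q hq0.le hq1 hμ0 hμM hμ1
  have nmean : ∑ h ∈ Finset.range (M + 1), (h : ℝ) * gate μ q h = q * T := sum_mul_gate μ q M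
  have htaν : y * (M : ℝ) ≤ q * T := by rw [hy, mul_assoc]; exact mul_le_mul_of_nonneg_left hta hq0.le
  -- the slice theorem: `slice (gate_q μ) a g` is DEC(j) at `qT + ag`
  have hΛ : DECAtT y (q * T + (a : ℝ) * g) j (M + a) (slice (gate μ q) a g) := by
    refine sliceClosedWindowT_holds y g (q * T) M a j (gate μ q) hy0 hy1 (hyqg.trans (by nlinarith)) hg1 ha n0 nM n1
      (by omega) ?_
    intro j'' _ _
    by_cases hjM : j'' < M
    · have := hS q hq0 hqQ j'' hjM
      rwa [decAt_iff_decAtT, nmean] at this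
    · have htop : ∀ h, 0 < gate μ q h → y * (h : ℝ) ≤ ∑ k ∈ Finset.range (M + 1), (k : ℝ) * gate μ q k := by
        intro h hh
        have hhM : h ≤ M := by
          by_contra hc
          exact (ne_of_gt hh) (nM h (not_le.1 hc))
        rw [nmean]
        have : y * (h : ℝ) ≤ y * M := mul_le_mul_of_nonneg_left (by exact_mod_cast hhM) hy0.le
        linarith
      have := decAt_of_top_le M (gate μ q) n0 nM n1 y hy1 htop j'' (not_lt.1 hjM)
      rwa [decAt_iff_decAtT, nmean] at this
  have hzν : 1 - q ≤ gate μ q 0 := by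
    have e : gate μ q 0 = q * μ 0 + (1 - q) := by simp [gate]
    rw [e]; nlinarith [hμ0 0]
  have hmove := decAtT_gateMoveBlob_of_twinMove hTM y (1 - q) g (q * T) a j M (gate μ q) hy0 hy1 (by linarith) hg1
    (by rw [hy]; nlinarith) ha n0 nM n1 nmean.symm htaν hzν hΛ
  have hlaw : (fun h => slice (gate μ q) a g h + g * (1 - q) * ((if h = 0 then (1 : ℝ) else 0) - (if h = a then (1 : ℝ) else 0)))
      = gate (slice μ a g) q := by
    funext h
    by_cases h0 : h = 0
    · rw [h0]
      have h1 : ¬ (a ≤ 0) := by omega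
      have h2 : ¬ ((0 : ℕ) = a) := by omega
      simp only [gate, slice, h1, h2, if_false, if_true, mul_zero, add_zero, sub_zero]
      ring
    · by_cases h1 : h = a
      · rw [h1]
        have h2 : ¬ (a = 0) := by omega
        simp only [gate, slice, le_refl, if_true, Nat.sub_self, h2, if_false]
        ring
      · by_cases hah : a ≤ h
        · have h2 : ¬ (h - a = 0) := by omega
          simp only [gate, slice, hah, if_true, h0, h1, h2, if_false]
          ring
        · simp only [gate, slice, hah, h0, h1, if_false]
          ring
  have hsmean : ∑ h ∈ Finset.range (M + a + 1), (h : ℝ) * slice μ a g h = T + (a : ℝ) * g := sum_mul_slice μ a g M hμM hμ1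
  rw [decAt_iff_decAtT, sum_mul_gate, hsmean]
  have et : q * (T + (a : ℝ) * g) = q * T + (a : ℝ) * g - (1 - q) * (a : ℝ) * g := by ring
  rw [et, ← hlaw]
  exact hmove

/-- **`TwinMoveDEC ⟹ SDEC IS CLOSED UNDER SLICING BY ANY HEAVY BLOB** (`Q = 1`). [this work] -/
theorem sdec_slice_blob_of_twinMove (hTM : TwinMoveDEC) (x g : ℝ) (M a : ℕ) (μ : ℕ → ℝ) (hx0 : 0 < x) (hx1 : x < 1)
    (hxg : x ≤ g) (hg1 : g ≤ 1) (ha : 1 ≤ a) (hμ0 : ∀ h, 0 ≤ μ h) (hμM : ∀ h, M < h → μ h = 0)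
    (hμ1 : ∑ h ∈ Finset.range (M + 1), μ h = 1)
    (hta : x * (M : ℝ) ≤ ∑ h ∈ Finset.range (M + 1), (h : ℝ) * μ h) (hS : SDEC x M μ) :
    SDEC x (M + a) (slice μ a g) := by
  rw [← sdecUpTo_one_iff] at hS ⊢
  exact sdecUpTo_slice_blob_of_twinMove hTM x 1 g M a μ hx0 le_rfl (by rwa [one_mul]) hxg hg1 ha hμ0 hμM hμ1 hta hS

end LawDec

end Quant

end Summit.CriticalPhenomena.PercolationContinuityZ3.Theorems
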